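/-
Copyright: the b2b-balaban cell (near-miss cell 7), T⁴-continuum fan-out; row NE7b ROUND-2 swarm, seat
t4-ne7b-formalise-leaf-02 (gen 3) — sub-row S6g′(a)-TOTAL, file 4 (the dating display on the PEDIGREE road).
Released under the licence of the surrounding project.
-/
import Summits.QuantumFields.BalabanUV.T4Continuum.Support.HistoryZoneMassDating
import Summits.QuantumFields.BalabanUV.T4Continuum.Support.HistoryGenTimed

/-!
# The dating display is FREE on the pedigree road: renewal strictness of every tagged genealogy `genT`, and the
# dating from «oldest line first» (row S6g′(a)-TOTAL, file 4)

Summits-side support leaf of the T⁴-continuum cell (rung (B)+1 on a FINITE torus only; NOT infinite volume, NOT the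
mass gap, NOT the Clay statement; NOT a proof of the spine estimate NE7b).  Row NE7b, route «COUNT», row S6g′
«MASS-BASED SIBLING COUNT».  The TOTAL (`HistoryZoneMassTotal`, p213527) displays `Dated st s t G`; file 3
(`HistoryZoneMassDating`, p213890) derives it from `T4CanonicalMenus.Chrono` + `RenewStrict`, and `RenewStrict` from
`ConsistentT` (renewal AT reach) — leaving the LE road (renewal no later than reach) displayed.  THIS file closes the
display on the road the instance ENDs actually take — leaf-09's PEDIGREES (`HistoryGen.Pedigree.genT`): (1) EVERY
tagged genealogy `P.genT c` is renewal-strict, with NO timing hypothesis at all — a renewed old part is a component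
of a STRICTLY EARLIER step (`Pedigree.step_lt`, built into the carrier), its genealogy's events are dated no later than
its step (`maxStep_genT_le`), and the renewal tag is dated at the step of the renewing component; (2) hence under
«oldest line first» (`HeadOldest`, already a field `headOldest` of the realised readings `RealisedReading(R)` ∕
`RealisedDomains(R)` — leaf-09's `chronoC_genT`) the genealogy is dated, lax under its own step and strictly one step
later; (3) datings transport along step-preserving relabellings (the shape tree `relabel (shape ∘ sh) G`).
[folklore] structural recursion on the lineage's carriers; nothing is quoted from print, nothing printed is asserted,
no `[cite:]` tag, no `Prop`-valued fact of Bałaban's minted.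

WHAT.  §1 `renewStrict_chainMerge`, **`renewStrict_genT`** (unconditional).  §2 **`dated_genT`** (`(∀ c, P.HeadOldest c) →
P.step c ≤ t → Dated (PEv.step ∘ Prod.fst) false t (P.genT c)`), **`dated_strict_genT`** (`P.step c < t ⇒ Dated … true t`)
— with `TimedLE.step_le` ∕ `Timed.step_le` (`P.step c ≤ K`) this is the TOTAL's `hD` at `T := K + 1` on BOTH roads.
§3 `renewStrict_relabel` ∕ `dated_relabel` (step-preserving relabellings).  §4 sanity.

HONEST SCOPE.  Bookkeeping over OUR carriers; after this file the only displayed inputs of the TOTAL on realised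
pedigrees are `HeadOldest` (an H3 reading convention already displayed by the ENDs) and `ZoneSkeleton.Chrono`
(leaf-06's `chrono_toGen` ∕ `chronoZ_shape_of_canon` supply it); `BirthShapeNodup` is NOT retired by this file; NE7b NOT
proved; spine 0∕9.  HONEST DEPENDENCY (cell): continuum YM on T⁴ ⇐ BetaPertH ∧ nine spine estimates (0/9 proved);
BetaPertH ⇐ (D1) ∧ (D4) ∧ CAP+tail; G-an2-4 gates asym, D1 and NE2/3/4.  This file changes none of it.
-/

open Literature.MathematicalPhysics.QuantumFieldTheory.Balaban1983to89
open T4PersistenceDictionary T4BranchingRecordsGas T4CanonicalMenus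
open Summit.QuantumFields.BalabanUV.T4Continuum.HistoryGen
open Summit.QuantumFields.BalabanUV.T4Continuum.HistoryZoneMassJoins
open Summit.QuantumFields.BalabanUV.T4Continuum.HistoryZoneMassDating

namespace Summit.QuantumFields.BalabanUV.T4Continuum.HistoryZoneMassDatingGen

/-! ## §1 Every tagged genealogy is renewal-strict -/

section Strict

variable {ε : Type*} {st : ε → ℕ}

/-- a binary-merger chain of renewal-strict structures is renewal-strict [folklore] -/
theorem renewStrict_chainMerge : ∀ (G : Gen ε) (Hs : List (Gen ε)) (t : ℕ → ε),
    RenewStrict st G → (∀ H ∈ Hs, RenewStrict st H) → RenewStrict st (chainMerge G Hs t)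
  | _, [], _, hG, _ => hG
  | G, H :: Hs, t, hG, hHs => by
      rw [chainMerge_cons]
      exact renewStrict_chainMerge _ Hs _ ((renewStrict_merge st _ _ _).2 ⟨hG, hHs H List.mem_cons_self⟩)
        fun H' h => hHs H' (List.mem_cons_of_mem _ h)

variable {α π : Type*} [DecidableEq α] [DecidableEq π]

/-- **EVERY TAGGED GENEALOGY IS RENEWAL-STRICT** (no timing hypothesis: a renewed old part is a component of a
strictly earlier step, `Pedigree.step_lt`; its events are dated no later than its step, `maxStep_genT_le`; the renewal
tag is dated at the renewing component's step). [folklore] -/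
theorem renewStrict_genT (P : Pedigree α π) (c : α) : RenewStrict (PEv.step ∘ Prod.fst) (P.genT c) := by
  rw [Pedigree.genT_eq]
  unfold Pedigree.partsGen
  -- every part genealogy is renewal-strict
  have hpart : ∀ (i : ℕ) (q : Part α π), q ∈ P.parts c →
      RenewStrict (PEv.step ∘ Prod.fst) (P.partGen c P.genT i q) := by
    intro i q hq
    rcases q with ⟨c', r⟩ | ⟨d, x⟩
    · have hlt := P.step_lt c c' r hq
      have ih := renewStrict_genT P c'
      rcases r with _ | _
      · exact ih
      · simp only [Pedigree.partGen, renewStrict_renew]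
        exact ⟨ih, (Pedigree.maxStep_genT_le (P := P) c').trans_lt hlt⟩
    · simp [Pedigree.partGen]
  cases hps : P.parts c with
  | nil => simp [Pedigree.join]
  | cons p ps =>
      rw [Pedigree.partsGenAux_cons]
      have hsub : ∀ q ∈ p :: ps, q ∈ P.parts c := fun q hq => by rw [hps]; exact hq
      show RenewStrict (PEv.step ∘ Prod.fst) (chainMerge _ _ _)
      refine renewStrict_chainMerge _ _ _ (hpart 0 p (hsub p List.mem_cons_self)) fun H hH => ?_
      obtain ⟨k, q, hq, rfl⟩ := P.mem_partsGenAux hH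
      exact hpart _ q (hsub q (List.mem_cons_of_mem _ hq))
termination_by P.step c
decreasing_by exact hlt

end Strict

/-! ## §2 The dating of a tagged genealogy from «oldest line first» -/

section Dating

variable {α π : Type*} [DecidableEq α] [DecidableEq π] {P : Pedigree α π}

/-- **THE LAX DATING OF A TAGGED GENEALOGY** under its component's step (or any later step), from `HeadOldest` alone.
[folklore] -/
theorem dated_genT (hH : ∀ c, P.HeadOldest c) (c : α) {t : ℕ} (ht : P.step c ≤ t) :
    Dated (PEv.step ∘ Prod.fst) false t (P.genT c) :=
  dated_of_canon (Pedigree.chronoC_genT hH c) (renewStrict_genT P c) ((Pedigree.maxStep_genT_le c).trans ht)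

/-- **THE STRICT DATING OF A TAGGED GENEALOGY** under any step beyond its component's step — the TOTAL's `hD` with
`T := K + 1` when `P.step c ≤ K` (`Timed.step_le` ∕ `TimedLE.step_le`). [folklore] -/
theorem dated_strict_genT (hH : ∀ c, P.HeadOldest c) (c : α) {t : ℕ} (ht : P.step c < t) :
    Dated (PEv.step ∘ Prod.fst) true t (P.genT c) :=
  dated_strict_of_canon (Pedigree.chronoC_genT hH c) (renewStrict_genT P c)
    (lt_of_le_of_lt (Pedigree.maxStep_genT_le c) ht)

end Dating

/-! ## §3 Transport along step-preserving relabellings -/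

section Relabel

variable {ε δ : Type*} (f : ε → δ) {st : ε → ℕ} {st' : δ → ℕ} (hst : ∀ e, st' (f e) = st e)
include hst

/-- renewal strictness survives a step-preserving relabelling [folklore] -/
theorem renewStrict_relabel : ∀ {G : Gen ε}, RenewStrict st G → RenewStrict st' (relabel f G)
  | Gen.born _ _, _ => trivial
  | Gen.renew Y e h, hR => by
      rw [renewStrict_renew] at hR
      rw [relabel_renew, renewStrict_renew, maxStep_relabel f hst, hst]
      exact ⟨renewStrict_relabel hR.1, hR.2⟩
  | Gen.merge A B e, hR => by
      rw [renewStrict_merge] at hR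
      rw [relabel_merge, renewStrict_merge]
      exact ⟨renewStrict_relabel hR.1, renewStrict_relabel hR.2⟩

/-- datings survive a step-preserving relabelling (e.g. the shape tree `relabel (shape ∘ sh) G`) [folklore] -/
theorem dated_relabel : ∀ {s : Bool} {t : ℕ} {G : Gen ε}, Dated st s t G → Dated st' s t (relabel f G)
  | s, t, Gen.born _ _, _ => by rw [relabel_born]; exact dated_born _ _ _ _
  | s, t, Gen.renew Y e h, hD => by
      rw [dated_renew] at hD
      rw [relabel_renew, dated_renew]
      exact dated_relabel hD
  | s, t, Gen.merge A B e, hD => by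
      rw [dated_merge] at hD
      rw [relabel_merge, dated_merge, hst]
      exact ⟨hD.1, hD.2.1, dated_relabel hD.2.2.1, dated_relabel hD.2.2.2⟩

end Relabel

/-! ## §4 Sanity (decided) -/

namespace Sanity

/-- a two-component pedigree on `Fin 2`: component `0` is a fresh region at step 2; component `1` (step 5) RENEWS it
and joins a new region — its tagged genealogy is `merge (renew (born …₂) (ren)₅ 2) (born …₅) (mer)₅`: renewal-strict
(events of the old line `≤ 2 < 5`) and dated lax under 5, as `renewStrict_genT` ∕ `dated_genT` predict; read off by
`decide` on the unfolded tree -/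
example : RenewStrict (PEv.step ∘ Prod.fst)
    ((⟨![2, 5], ![[Part.new 3 ()], [Part.old 0 true, Part.new 1 ()]], by decide⟩ : Pedigree (Fin 2) Unit).genT 1) :=
  renewStrict_genT _ 1

example : RenewStrict (fun n : ℕ => n) (Gen.merge (Gen.renew (Gen.born 2 2) 5 2) (Gen.born 5 5) 5) ∧
    Dated (fun n : ℕ => n) false 5 (Gen.merge (Gen.renew (Gen.born 2 2) 5 2) (Gen.born 5 5) 5) := by
  constructor
  · simp [RenewStrict, maxStep]
  · simp [Dated]

end Sanity

end Summit.QuantumFields.BalabanUV.T4Continuum.HistoryZoneMassDatingGen
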